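import Summits.CriticalPhenomena.CardyFormulaZ2.Theorems.CardyMagicRigidityNestingRigidityTomographyDictionaryZ2
import HarnessLib

/-!
# `ℤ²` disc duality at a clean collar: the named statement (corrected) and the dual dictionary it unlocks

Crux `Summit.CriticalPhenomena.CardyFormulaZ2.Theses.CardyMagicRigidity.NestingRigidity` (stmt-CriticalPhenomena-4835),
line `pinch-resampling` v4, stub S10' `stub_neckTomographyV4` (assembly item A4, `ℤ²` twin).  The DUAL dictionary of
neck tomography on `ℤ²`, `zGlueD_zState_iff_reachable` (`…NestingRigidityTomographyDictionaryZ2`, p165802), is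
displayed-conditional on "not primal-hooked ↔ dual-hooked at every selected region".  This file NAMES that planar input
as a `Prop` (nothing is asserted) and records the reduction:

* `ZDiscDuality` — **`ℤ²` disc duality at a clean collar**: for a LATTICE configuration `ω ⊆ E(ℤ²)` on the selection
  event `ZFourStrands x s` (exactly two primal-open crossing clusters of `Λ_{2s}(x) ∖ Λ_s(x)` and exactly two dual-open
  crossing clusters of the dual collar), the primal crossings are NOT all joined by an open path of `Λ_{2s}(x)` iff the
  dual crossings ARE all joined by a dual-open path of the dual box of radius `2s + ½`.
  CORRECTION of the wave-4 formulation (which had no hypothesis `ω ⊆ E(ℤ²)`): `openGraph ω = fromEdgeSet ω` does not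
  intersect with the lattice, so for a non-lattice `ω` the primal side may use "edges" that are not bonds of `ℤ²` while
  `dualConfig ω ⊆ E(ℤ²)` ignores them (`dualEdge_of_not_mem`); adding to a lattice configuration in
  `ZFourStrands x s ∖ ZHookR x s` (dual-hooked by the lattice statement) the two non-lattice pairs `{v, h}`, `{h, w}`
  (`v`, `w` primal crossings in the two primal clusters, `h` a vertex of the hole `Λ_s(x)`) keeps `ZFourStrands` (the
  collar paths are unchanged, `h ∉` collar), keeps the dual hook-up, and CREATES the primal hook-up `v – h – w` inside
  `Λ_{2s}(x)` — both hook-ups hold, the uncorrected equivalence fails.  Under `bondPercolation (zdGraph 2) half` the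
  lattice hypothesis holds almost surely, and the primal dictionary `zGlueP_zState_iff_reachable` already carries it.
* `zGlueD_zState_iff_reachable_of_zDiscDuality` (registered anchor) — the dual dictionary for the realised states,
  conditional on `ZDiscDuality` BY NAME (and on `ω ⊆ E(ℤ²)`).

WHY `ZDiscDuality` IS TRUE / WHAT IS MISSING (size XL; the `𝕋` proof `tDiscDuality_holds`, p165397, rests on the disc
theory of hexagon domains): (i) EXISTENCE — if two primal crossings are not joined through `Λ_{2s}(x)`, the dual
interface of the open `Λ_{2s}(x)`-cluster of one of them is a dual-open path of the dual box joining two dual crossings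
of distinct dual clusters (`ℤ²` analogue of `exists_closed_crossings_joined_through_ball`); (ii) EXCLUSIVITY — the
certified cyclic order of primal arms and dual interface chains on `∂Λ_{2s}(x)` (analogue of
`exists_frontierChains_alternating_of_lt`) and a primal-versus-dual non-interleaving lemma in a box (analogue of
`triBall_not_interleaved_shift`); the tree's `ℤ²` barrier lemmas (`not_openConnIn_sqAnnulus_of_dualArmsTB`,
`ZStrands.*`) cover arms in coordinate sectors only.

Sorry-free; the only `Prop` definition, `ZDiscDuality`, is used as a displayed hypothesis by name, never asserted.
-/

noncomputable section

namespace Summit.CriticalPhenomena.CardyFormulaZ2.Cruxes.NestingRigidity.PinchResampling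

open Summit.CriticalPhenomena.CardyFormulaZ2.Theses.CardyMagicRigidity
open Set Literature.Probability.Percolation Literature.Probability.LatticeModels

section DiscDualityZ2

/-- **`ℤ²` disc duality at a clean collar** (the planar input of the dual dictionary of neck tomography on `ℤ²`; the
`ℤ²` twin of `TDiscDuality` / `tDiscDuality_holds`): for a lattice configuration `ω ⊆ E(ℤ²)` with exactly two
primal-open crossing clusters of the primal collar `Λ_{2s}(x) ∖ Λ_s(x)` and exactly two dual-open crossing clusters of
the dual collar (`ZFourStrands x s`), the primal crossings are not all joined by an open path of `Λ_{2s}(x)`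
(`ω ∉ ZHookR x s`) iff the dual crossings are all joined by a dual-open path of the dual box of radius `2s + ½`.
(The lattice hypothesis is necessary: `openGraph ω` does not discard non-lattice pairs, `dualConfig ω` does.)  Size XL:
dual interfaces of primal box-clusters, certified cyclic order of the four strands, primal/dual non-interleaving. -/
def ZDiscDuality : Prop :=
  ∀ (ω : BondConfig (Site 2)) (x : Site 2) (s : ℕ), ω ⊆ (zdGraph 2).edgeSet → ω ∈ ZFourStrands x s →
    (ω ∉ ZHookR x s ↔ HookedUp (zdGraph 2) (openGraph (dualConfig ω)) (zDualBall x s) (zDualBall x (2 * s)))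

/-- **Registered anchor: the dual dictionary for the realised states on `ℤ²`, conditional on `ZDiscDuality` by name**
(cf. `zGlueD_zState_iff_reachable`, p165802, whose displayed hypothesis is `ZDiscDuality` instantiated at the selected
regions of the lattice configuration `ω`): with pairwise disjoint dual closed collars, two dual sites off the dual
closed collars are dual-glued under the realised state vector iff they lie in the same dual-open cluster. -/
theorem zGlueD_zState_iff_reachable_of_zDiscDuality :
    ZDiscDuality → ∀ {sc : Site 2 → ℕ} {X : Set (Site 2)} {ω : BondConfig (Site 2)}, ω ⊆ (zdGraph 2).edgeSet →
      (∀ x ∈ zSel sc X ω, ∀ y ∈ zSel sc X ω, x ≠ y → Disjoint (zDualBall x (2 * sc x)) (zDualBall y (2 * sc y))) →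
      ∀ {v w : Site 2}, v ∉ (⋃ x ∈ zSel sc X ω, zDualBall x (2 * sc x)) → w ∉ (⋃ x ∈ zSel sc X ω, zDualBall x (2 * sc x)) →
      (zGlueD sc X ω (zState sc X ω) v w ↔ (openGraph (dualConfig ω)).Reachable v w) :=
  fun h _ _ ω hω hdisj _ _ hv hw ↦ zGlueD_zState_iff_reachable hdisj (fun x hx ↦ h ω x _ hω hx.2) hv hw

/-- The two dictionaries together: under `ZDiscDuality`, for a lattice configuration with pairwise disjoint primal
AND dual closed collars, the realised state vector reads the primal clusters off the primal closed collars and the dual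
clusters off the dual closed collars. -/
theorem zGlue_zState_dictionaries_of_zDiscDuality (h : ZDiscDuality) {sc : Site 2 → ℕ} {X : Set (Site 2)}
    {ω : BondConfig (Site 2)} (hω : ω ⊆ (zdGraph 2).edgeSet)
    (hdisjP : ∀ x ∈ zSel sc X ω, ∀ y ∈ zSel sc X ω, x ≠ y → Disjoint (zBall x (2 * sc x)) (zBall y (2 * sc y)))
    (hdisjD : ∀ x ∈ zSel sc X ω, ∀ y ∈ zSel sc X ω, x ≠ y → Disjoint (zDualBall x (2 * sc x)) (zDualBall y (2 * sc y))) :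
    (∀ {v w : Site 2}, v ∉ (⋃ x ∈ zSel sc X ω, zBall x (2 * sc x)) → w ∉ (⋃ x ∈ zSel sc X ω, zBall x (2 * sc x)) →
      (zGlueP sc X ω (zState sc X ω) v w ↔ (openGraph ω).Reachable v w)) ∧
    (∀ {v w : Site 2}, v ∉ (⋃ x ∈ zSel sc X ω, zDualBall x (2 * sc x)) →
      w ∉ (⋃ x ∈ zSel sc X ω, zDualBall x (2 * sc x)) →
      (zGlueD sc X ω (zState sc X ω) v w ↔ (openGraph (dualConfig ω)).Reachable v w)) :=
  ⟨fun hv hw ↦ zGlueP_zState_iff_reachable hω hdisjP hv hw,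
    fun hv hw ↦ zGlueD_zState_iff_reachable_of_zDiscDuality h hω hdisjD hv hw⟩

end DiscDualityZ2

end Summit.CriticalPhenomena.CardyFormulaZ2.Cruxes.NestingRigidity.PinchResampling

end
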